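import Literature.AlgebraicGeometry.ShimuraVarieties.UnitaryShimuraCanonicalModelUnique
import Literature.AlgebraicGeometry.ShimuraVarieties.UnitaryShimuraComplexRecordSystemIso
import Literature.AlgebraicGeometry.ShimuraVarieties.UnitaryShimuraRecordDescent
import HarnessLib

/-!
# Two record systems of `Sh(U(H), 𝔹²)` at one datum have isomorphic models, GIVEN the printed uniqueness of the
# canonical model ([Milne 2005] Thm. 13.7 (a); [Deligne 1979] 2.2.6 ∕ 2.7.12)

Topic `AlgebraicGeometry/ShimuraVarieties`; namespace `Literature.AlgebraicGeometry.ShimuraVarieties`, grouping sub-namespace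
`UnitaryCanonicalModel`.  THEOREMS ONLY; the named fact `canonicalModel_unique_printed` (row I-4 of the cell `hodgecm-mathlib`,
`UnitaryShimuraCanonicalModelUnique`) is a HYPOTHESIS `(hU : …)` of every theorem; nothing is discharged, no named fact is added
(net Literature debt 0).

`canonicalModel_unique_printed` identifies two CANONICAL `L`-forms `(M, e)`, `(M′, e′)` of ONE complex record system `Sc`.  Two
record systems `S, S′ : RecordSystem L H τ T hT K₀` (Deligne's models over `L` WITH their own complex clauses) live over possibly
DIFFERENT algebraisations of the ball quotients `Sh_K(ℂ)`; by the tree's system-level Borel uniqueness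
(`ComplexRecordSystem.nonempty_isoOfPts`, `RecordSystem.exists_iso_complexRecordSystem` — [Deligne1979ShimuraVarieties] 2.1.2 «unique
[Borel]») `S` is ALSO an `L`-form WITH RECIPROCITY of the complex shadow of `S′` (`RecordSystem.exists_descent`), while `S′` is one
along the identity (`RecordSystem.descent_self`).  Hence:

* **`RecordSystem.existsUnique_iso_of_canonicalModel_unique`** / **`RecordSystem.nonempty_iso_of_canonicalModel_unique`** — under
  the hypotheses of the fact (`H` positive definite off the place of `τ`, anisotropic; `K₀` with torsion-free conjugate arithmetic
  levels), ANY two record systems `S, S′` at the datum `(L, H, τ, T, hT, K₀)` have isomorphic model functors `φ : S.M ≅ S′.M`,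
  COMPATIBLY WITH THE COMPLEX POINTS: `φ_K ⊗_{L,τ} ℂ` carries `S.pts_K⁻¹ [z, aK]` to `S′.pts_K⁻¹ [z, aK]` — and such a `φ` is unique.

This is the assembly step «B3 + I-4» of the cell's off-place cone for `HypLiu418` (director g1 03:47:12Z: (3) `recordOf_conjTwist_iso`
= I-4 + B1 + B2 + B3; B1/B3 in tree, B2 = A-p06/A-p08): with it, the CHOSEN record at a conjugate datum and the transported record of
`RecordSystemConj.exists_conj` ∘ `RecordSystem.exists_alongConj` are isomorphic as soon as they sit at literally the same datum.
HC_CM is proved only modulo the 7 printed citations until rung 0 closes; this file discharges none of them.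

## References
* [Milne2005ShimuraVarieties] J. S. Milne, *Introduction to Shimura varieties* (2005/2017), Thm. 13.7 (a) p. 119, Prop. 13.1 ∕ Cor. 13.2
  p. 117, Def. 12.8 (62) p. 114.
* [Deligne1979ShimuraVarieties] P. Deligne, *Variétés de Shimura* (1979), 2.1.2, 2.2.5–2.2.6, 2.7.12 (PDF pp. 24, 29, 50 of Milne's translation).
-/

set_option autoImplicit false

noncomputable section

open Function MulAction Topology NumberField IsDedekindDomain CategoryTheory CategoryTheory.Limits Matrix
  AlgebraicGeometry
open scoped Matrix ComplexOrder
open Literature.AlgebraicGeometry.Motives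
open Literature.NumberTheory.Automorphic Literature.NumberTheory.Automorphic.UnitaryGroup
open Literature.NumberTheory.Automorphic.Liu2021.AppendixC (C5.OpenCompactSubgroup C5.SmallLevel)
open Literature.Geometry.ComplexHyperbolic Literature.Geometry.ComplexHyperbolic.BallModel
open Literature.NumberTheory.Automorphic.ShimuraDissection

namespace Literature.AlgebraicGeometry.ShimuraVarieties

namespace UnitaryCanonicalModel

variable {L : Type} [Field L] [NumberField L] [IsCMField L] {H : Matrix (Fin 3) (Fin 3) L}
  {τ : L →+* ℂ} {T : GL (Fin 3) ℂ} {hT : formCongr (starRingEnd ℂ) T (H.map τ) = BallModel.J}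
  {K₀ : C5.OpenCompactSubgroup ↥(finAdelic (↥(maximalRealSubfield L)) L (IsCMField.complexConj L) 3 H)}

set_option maxHeartbeats 1600000 in -- large adelic / Shimura-set terms: instance-heavy statement (as the sibling files)
/-- **Two record systems at one datum have isomorphic models, by a UNIQUE isomorphism compatible with the complex forms — given
[Milne2005ShimuraVarieties] Thm. 13.7 (a) as printed** (`canonicalModel_unique_printed`, HYPOTHESIS).  For `S, S′ : RecordSystem L H τ T hT K₀`
(datum as in the fact: `H` positive definite off the place of `τ`, anisotropic, `K₀` with torsion-free conjugate arithmetic levels), let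
`e₁ : S.M ⊗_{L,τ} ℂ ≅ S′.M ⊗_{L,τ} ℂ` be the Borel comparison of the two complex shadows through which the points correspond
(`RecordSystem.exists_iso_complexRecordSystem S S′.complexRecordSystem`).  Then there is a UNIQUE `φ : S.M ≅ S′.M` with
`φ_K ⊗_{L,τ} ℂ = (e₁)_K` for all `K` — Thm. 13.7 (a) applied to the two canonical forms `(S′.M, 𝟙)` (`descent_self`) and `(S.M, e₁)`
(reciprocity (F3) of `S` transported, as in `exists_descent`) of the ONE complex record system `S′.complexRecordSystem`.
[cite: Milne2005ShimuraVarieties, Thm. 13.7 (a) p. 119; Prop. 13.1 ∕ Cor. 13.2 p. 117] [cite: Deligne1979ShimuraVarieties, 2.1.2 and 2.2.5–2.2.6 (PDF pp. 24, 29 of Milne's translation)] -/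
theorem RecordSystem.existsUnique_iso_of_canonicalModel_unique (hU : canonicalModel_unique_printed)
    (hpos : ∀ τ' : L →+* ℂ, InfinitePlace.mk τ' ≠ InfinitePlace.mk τ → (H.map τ').PosDef)
    (hanis : ∀ v : Fin 3 → L, hermForm (cmConjRingHom L) H v v = 0 → v = 0)
    (htf : ∀ g : finAdelic (↥(maximalRealSubfield L)) L (IsCMField.complexConj L) 3 H,
      ∀ γ ∈ arithmeticLevel (↥(maximalRealSubfield L)) L (IsCMField.complexConj L) 3 H
        (K₀.1.map (MulAut.conj g).toMonoidHom), IsOfFinOrder γ → γ = 1)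
    (S S' : RecordSystem L H τ T hT K₀) (e₁ : (S.M ⋙ Motives.baseChangeHom τ) ≅ S'.complexRecordSystem.Mc)
    (he₁ : letI : Algebra L ℂ := τ.toAlgebra
      ∀ (K : C5.SmallLevel K₀) (P : ShimuraSet L H τ T hT K.1.1),
        (AlgPoints.baseChangeEquiv τ (S.M.obj K)).symm
          (AlgPoints.map (e₁.inv.app K) ((S'.complexRecordSystem.pts K).symm P)) = (S.pts K).symm P) :
    ∃! φ : S.M ≅ S'.M, ∀ K : C5.SmallLevel K₀, (Motives.baseChangeHom τ).map (φ.hom.app K) = e₁.hom.app K := by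
  letI : Algebra L ℂ := τ.toAlgebra
  -- the two canonical forms of `S′.complexRecordSystem`: `(S.M, e₁)` and `(S′.M, 𝟙)`
  have hM : IsCanonicalDescentAt S'.complexRecordSystem S.M e₁ := by
    intro K σ s hσ v₃ x hx d hd a
    rw [he₁, he₁]
    exact S.recip K σ s hσ v₃ x hx d hd a
  have hM' : IsCanonicalDescentAt S'.complexRecordSystem S'.M (Iso.refl _) := S'.descent_self
  obtain ⟨φ, hφ, huniq⟩ := hU L H τ T hT hpos hanis K₀ htf S'.complexRecordSystem S.M S'.M S.smooth S.projective
    S'.smooth S'.projective e₁ (Iso.refl _) hM hM'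
  refine ⟨φ, fun K => ?_, fun ψ hψ => huniq ψ fun K => ?_⟩
  · have h := hφ K
    erw [Category.comp_id] at h
    exact h
  · have h := hψ K
    erw [Category.comp_id]
    exact h

set_option maxHeartbeats 1600000 in -- large adelic / Shimura-set terms
/-- **Two record systems at one datum have isomorphic models, compatibly with the complex points — given [Milne2005ShimuraVarieties]
Thm. 13.7 (a) as printed** (`canonicalModel_unique_printed`, HYPOTHESIS): for `S, S′ : RecordSystem L H τ T hT K₀` there is
`φ : S.M ≅ S′.M` such that `φ_K ⊗_{L,τ} ℂ`, read on complex points, carries `S.pts_K⁻¹ [z, aK]` to `S′.pts_K⁻¹ [z, aK]` for every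
`[z, aK] ∈ Sh_K(ℂ)`.  The Borel comparison `e₁` of the two complex shadows exists (`RecordSystem.exists_iso_complexRecordSystem`,
[Deligne1979ShimuraVarieties] 2.1.2), both `(S.M, e₁)` and `(S′.M, 𝟙)` are canonical forms of `S′.complexRecordSystem`, and Thm. 13.7 (a)
identifies them (`existsUnique_iso_of_canonicalModel_unique`).  Assembly step «B3 + I-4» of the off-place cone of `HypLiu418`.
[cite: Milne2005ShimuraVarieties, Thm. 13.7 (a) p. 119; Prop. 13.1 ∕ Cor. 13.2 p. 117] [cite: Deligne1979ShimuraVarieties, 2.1.2 and 2.2.5–2.2.6 (PDF pp. 24, 29 of Milne's translation)] -/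
theorem RecordSystem.nonempty_iso_of_canonicalModel_unique (hU : canonicalModel_unique_printed)
    (hpos : ∀ τ' : L →+* ℂ, InfinitePlace.mk τ' ≠ InfinitePlace.mk τ → (H.map τ').PosDef)
    (hanis : ∀ v : Fin 3 → L, hermForm (cmConjRingHom L) H v v = 0 → v = 0)
    (htf : ∀ g : finAdelic (↥(maximalRealSubfield L)) L (IsCMField.complexConj L) 3 H,
      ∀ γ ∈ arithmeticLevel (↥(maximalRealSubfield L)) L (IsCMField.complexConj L) 3 H
        (K₀.1.map (MulAut.conj g).toMonoidHom), IsOfFinOrder γ → γ = 1)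
    (S S' : RecordSystem L H τ T hT K₀) :
    ∃ φ : S.M ≅ S'.M,
      letI : Algebra L ℂ := τ.toAlgebra
      ∀ (K : C5.SmallLevel K₀) (P : ShimuraSet L H τ T hT K.1.1),
        (AlgPoints.baseChangeEquiv τ (S'.M.obj K)).symm
            (AlgPoints.map ((Motives.baseChangeHom τ).map (φ.hom.app K))
              (AlgPoints.baseChangeEquiv τ (S.M.obj K) ((S.pts K).symm P))) =
          (S'.pts K).symm P := by
  letI : Algebra L ℂ := τ.toAlgebra
  -- Borel comparison of the two complex shadows, compatible with `pts` (system level)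
  obtain ⟨e₁, he₁⟩ := S.complexRecordSystem.nonempty_isoOfPts S'.complexRecordSystem
  have he₁' : ∀ (K : C5.SmallLevel K₀) (P : ShimuraSet L H τ T hT K.1.1),
      (AlgPoints.baseChangeEquiv τ (S.M.obj K)).symm
        (AlgPoints.map (e₁.inv.app K) ((S'.complexRecordSystem.pts K).symm P)) = (S.pts K).symm P := fun K P =>
    (congrArg (AlgPoints.baseChangeEquiv τ (S.M.obj K)).symm
      (ComplexRecordSystem.map_inv_app_pts_symm e₁ he₁ K P)).trans
      (Equiv.symm_apply_apply (AlgPoints.baseChangeEquiv τ (S.M.obj K)) ((S.pts K).symm P))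
  obtain ⟨φ, hφ, -⟩ :=
    RecordSystem.existsUnique_iso_of_canonicalModel_unique hU hpos hanis htf S S' e₁ he₁'
  refine ⟨φ, fun K P => ?_⟩
  -- `φ_K ⊗ ℂ = (e₁)_K` sends `S.pts_K⁻¹ P` (read in `(M_K)_τ(ℂ)`) to `S′.pts_K⁻¹ P` (`map_hom_app_pts_symm`)
  rw [hφ K]
  exact (congrArg (AlgPoints.baseChangeEquiv τ (S'.M.obj K)).symm
    (ComplexRecordSystem.map_hom_app_pts_symm e₁ he₁ K P)).trans
    (Equiv.symm_apply_apply (AlgPoints.baseChangeEquiv τ (S'.M.obj K)) ((S'.pts K).symm P))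

end UnitaryCanonicalModel

end Literature.AlgebraicGeometry.ShimuraVarieties

end
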